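import Mathlib
import Summits.ResolutionOfSingularities.ResolutionOfSingularities.Theorems.WeightedInvariantLocalWeightedDropWildMonicFlagDropKangarooTangent
import Summits.ResolutionOfSingularities.ResolutionOfSingularities.Theorems.WeightedInvariantLocalWeightedDropWildMonicFlagDropKangarooPackage
import Summits.ResolutionOfSingularities.ResolutionOfSingularities.Theorems.WeightedInvariantLocalWeightedDropWildMonicFlagDropKangarooCaseTwoCore

/-!
# `WeightedInvariant.LocalWeightedDrop`, line `hasse-ridge-face-selection`, S3ρ flag line: Uk-ρD3 — `DropKangarooTangent` HOLDS
# (Perlega Prop. 9.1.4 case (4) at a TRANSLATED point `t ≠ 0`)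

Crux item stmt-ResolutionOfSingularities-8899 `LocalWeightedDrop` (route `ResolutionOfSingularities/WeightedInvariant`), engine of the door
`HypersurfaceCentreConstruction` stmt-ResolutionOfSingularities-19897.  [OURS · L1 W4.3, chain w43, seat res-type-056 (Uk-ρD3, res-type-083's split
`…WildMonicFlagDropKangarooSplit`).  MODEL: S. Perlega, arXiv:2011.14443, proof of Prop. 9.1.4 case (4) with `t ≠ 0`, `E = V(xy)` [cite: Perlega2020,
Prop. 9.1.4 (4) p0106: «Set `y₁ = y − tx` … Let the flag `𝓕` be defined by `𝓕₂ = V(z)` and `𝓕₁ = V(z, y₁)`. Hence … `n_𝓕 = 1` if `t ≠ 0` … we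
can assume that `f` is clean with respect to `J_{2,x₁}(a)` for any weighted order function … this implies that `𝓕` is valid. Further, we can
assume by Lemma (super_s_r_lemma) that `d_𝓕 ≠ −1` … `d_𝓖 ≤ d₁/n_𝓖 ≤ d_𝓕/n_𝓖 + ε`»; Prop. 6.1.1 (2); Prop. 6.2.4 (2) (`n·d₁ ≤ γ`); Lemma 9.1.3];
TEMPLATE: res-L1-w43-stub-2's `…WildMonicFlagDropKangarooCaseTwoCore.exists_parent_flag_of_translated` (case (2), same parent flag); every
object OURS; not a statement of any manuscript [claim: Hironaka2017, status: under-review].]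

* `exists_translated_package` — for a kangaroo step `(A, E ∋ 0, 1; t ≠ 0; T, φ′)` and a tangency `n ≥ 2`: the sheared parent `A^{(t)} = θ_{t·x}^* A`
  has `T` as AXIS successor; `K := m* + 1` past the `(1,1)`-maximum of its re-centrings; ONE re-centring `g₀` simultaneously clean for the
  perturbed weight `(K, K+1)` (⇒ the tangent parent flag `(g₀, t·X)`, `n_𝓕 = 1`, is VALID) and for `(n, n+1)` (⇒ the induced child tuple is
  `(n,1)`-clean, Prop. 6.1.1 (2)), lowering no `m_w` (⇒ no linear `x₀`-term, so the induced child re-centring `g′` has `g′(0) = 0`); the child's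
  Newton set is `Ψ_{d!}` of the parent's, so `n · dInit ≤ γ = initHeight 1` (Prop. 6.2.4 (2)); letter swap `ψ = swap g′`; and the conventions
  of `dFlagN d! 1`: `= initHeight 1` unless `initHeight 1 = 0` (then the bound is `0`) or Perlega's `d_𝓕 = −1` (`0 < γ < d!`, `d! ∣ δ`), which
  by Lemma 9.1.3 (stub-5's `exists_lt_of_lost_image_psi` / `termSR_shape_of_lost_image_psi`) makes the child an `Exit₃` position — excluded.
  This is `TranslatedPackageKangaroo` WITHOUT the positivity `0 < d_𝓕`, which can fail (e.g. `in_δ` of the parent containing a pure `x`-power).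
* `dropKangarooTangent_holds : DropKangarooTangent d p k` — if `0 < d_𝓕`: res-type-056's kangaroo bound `dFlagN_shift_lt` gives
  `d_𝓖 < d_𝓕` and `(d_𝓖, n, 0) < (d_𝓕, 1, 0) ≤ vmax`; if `d_𝓕 = 0`: `dInit = 0`, so `d_𝓖 = 0` (`dFlagN_shift_eq_zero_of_dInit_eq_zero`), and
  stub-1's valid parent flag with positive first entry (`exists_isFlagTriple_fst_pos`) lies below `vmax`, so `(0, n, 0) < vmax`.
AI-written; gate-accepted means sorry-free with standard axioms, not refereed.
-/

set_option linter.dupNamespace false -- mandated namespace of this single-conjunct summit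

noncomputable section

namespace Summit.ResolutionOfSingularities.ResolutionOfSingularities.Theorems

open Literature.AlgebraicGeometry.Resolution
open Literature.AlgebraicGeometry.Resolution.HauserPerlega2024 (Triple)

namespace WildMonic

open MvPowerSeries MonicDescent
open PurePowerFlag (swap swapE orient orientE IsN0 IsTangent succE)

variable {k : Type} [Field k] {d : ℕ}

/-- THE TRANSLATED KANGAROO PACKAGE WITHOUT POSITIVITY (see the module docstring): a valid parent tangent flag `(g₀, t·X)` and a
`(1,n)`-cleaning re-centring `ψ` of the swapped child with `n · dInit ≤ dFlagN d! 1` of the parent flag. -/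
theorem exists_translated_package (p : ℕ) [Fact p.Prime] [CharP k p] [PerfectRing k p]
    {A : Fin d → MvPowerSeries (Fin 2) k} {E : Finset (Fin 2)} {t : k} {T : Fin d → MvPowerSeries (Fin 2) k}
    {φ' : MvPowerSeries (Fin 2) k} {vmax : Triple} (hstep : IsKangarooStep d p A E t T φ' vmax) {n : ℕ} (hn : 2 ≤ n) :
    ∃ (g₀ ψ : MvPowerSeries (Fin 2) k), constantCoeff g₀ = 0 ∧ constantCoeff ψ = 0 ∧
      IsMMax d A E g₀ (PowerSeries.C t * PowerSeries.X) ∧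
      IsWClean p ![1, n] (flagTuple d (swapT (shift d T φ')) ψ 0) ∧
      wMin ![1, n] (flagTuple d (swapT (shift d T φ')) ψ 0) ≠ ⊤ ∧
      n * dInit ![1, n] (newtonSet (flagTuple d (swapT (shift d T φ')) ψ 0)) ≤
        dFlagN d.factorial 1 (newtonSet (flagTuple d A g₀ (PowerSeries.C t * PowerSeries.X))) := by
  classical
  obtain ⟨hA, hexA, -, -, -, ht, h0E, h1E, hT, hφ', hpos', hex'⟩ := hstep
  have hd : 0 < d := by
    refine Nat.pos_of_ne_zero fun hd0 => ?_
    subst hd0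
    exact hexA (exit₃_of_eq_zero hA fun j => j.elim0)
  have hn1 : 1 ≤ n := by omega
  set L : ℕ := d.factorial with hL
  -- Step 1: the sheared parent `A^{(t)}`, whose AXIS successor is `T`; its re-centrings are the parent flag tuples along `t·X`
  set Ash : Fin d → MvPowerSeries (Fin 2) k :=
    fun j => subst (PurePowerFlag.shift (PowerSeries.C t * PowerSeries.X)) (A j) with hAsh
  have hAsh_pos : IsPos d Ash := isPos_shiftCX t hA
  have hAsh_ex : ¬ Exit₃ p d Ash := not_exit₃_shiftCX t hexA
  have hAsh0 : ∀ j, constantCoeff (Ash j) = 0 := constantCoeff_eq_zero_of_isPos hAsh_pos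
  have hT0 : ∀ j : Fin d, (X 0 : MvPowerSeries (Fin 2) k) ^ (d - (j : ℕ)) * T j = subst (PlaneGerm.dirChart (0 : k)) (Ash j) :=
    fun j => axis_successor_of_shiftCX t hT j
  have hflagF : ∀ g' : MvPowerSeries (Fin 2) k, flagTuple d A g' (PowerSeries.C t * PowerSeries.X) = shift d Ash g' := by
    intro g'
    have h := flagTuple_shiftCX t A g' (h := 0) (map_zero _)
    rw [add_zero, flagTuple_zero_shear] at h
    exact h.symm
  -- Step 2: the `(1,1)`-maximum `m*` over the re-centrings of `A^{(t)}`; `K = m* + 1`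
  obtain ⟨g₁, hg₁0, -, hclean₁⟩ := exists_shift_isWClean_or_eq_zero p ![1, 1] hd Ash hAsh0
  have hne₁ : shift d Ash g₁ ≠ 0 := fun h0 => hAsh_ex (exit₃_of_shift_eq_zero p hg₁0 h0)
  have hP₁ne : wMin ![1, 1] (shift d Ash g₁) ≠ ⊤ := wMin_ne_top_of_ne_zero _ hne₁
  have hclean₁' : IsWClean p ![1, 1] (shift d Ash g₁) := hclean₁.resolve_right hne₁
  have hmax₁ : ∀ g' : MvPowerSeries (Fin 2) k, wMin ![1, 1] (shift d Ash g') ≤ wMin ![1, 1] (shift d Ash g₁) :=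
    fun g' => wMin_shift_le_of_isWClean_shift p ![1, 1] Ash hclean₁' hP₁ne g'
  set mstar : ℕ := (wMin ![1, 1] (shift d Ash g₁)).toNat with hmstar
  have hmstar_ge : ∀ g' : MvPowerSeries (Fin 2) k, wOrdN 1 (newtonSet (shift d Ash g')) ≤ mstar := by
    intro g'
    rw [wOrdN_newtonSet_eq, hmstar]
    exact ENat.toNat_le_toNat (hmax₁ g') hP₁ne
  set K : ℕ := mstar + 1 with hK
  -- Step 3: the parent hypersurface: `P = shift d A^{(t)} g₀` clean for `(K, K+1)` AND `(n, n+1)`, no `m_w` lowered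
  obtain ⟨g₀, hg₀0, hmono, hor⟩ := exists_shift_isWClean_list p hd Ash hAsh0 [![K, K * 1 + 1], ![n, n + 1]]
  have hne₀ : shift d Ash g₀ ≠ 0 := fun h0 => hAsh_ex (exit₃_of_shift_eq_zero p hg₀0 h0)
  obtain ⟨hws, -⟩ := hor.resolve_right hne₀
  have hcleanK : IsWClean p ![K, K * 1 + 1] (shift d Ash g₀) := hws _ (by simp)
  have hcleanN : IsWClean p ![n, n + 1] (shift d Ash g₀) := hws _ (by simp)
  have hPne : wMin ![K, K * 1 + 1] (shift d Ash g₀) ≠ ⊤ := wMin_ne_top_of_ne_zero _ hne₀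
  have hmaxP : ∀ g' : MvPowerSeries (Fin 2) k, wMin ![K, K * 1 + 1] (shift d Ash g') ≤ wMin ![K, K * 1 + 1] (shift d Ash g₀) :=
    fun g' => wMin_shift_le_of_isWClean_shift p _ Ash hcleanK hPne g'
  have hPpos : ∀ j : Fin d, ((d - (j : ℕ) : ℕ) : ℕ∞) ≤ (shift d Ash g₀ j).order := fun j => by
    rw [← flagTuple_zero_shear]; exact le_order_flagTuple hAsh_pos hg₀0 (map_zero _) j
  have hPN : (newtonSet (shift d Ash g₀)).Nonempty := newtonSet_shift_nonempty_of_not_exit₃ hAsh_ex hg₀0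
  have hPL : ∀ Q ∈ newtonSet (shift d Ash g₀), L ≤ Q 0 + Q 1 := fun Q hQ => factorial_le_of_mem_newtonSet hPpos hQ
  have hmP : wOrdN 1 (newtonSet (shift d Ash g₀)) ≤ mstar := hmstar_ge g₀
  have hKP : initHeight 1 (newtonSet (shift d Ash g₀)) < K :=
    lt_of_le_of_lt ((initHeight_le_wOrdN Nat.one_pos hPN).trans hmP) (Nat.lt_succ_self _)
  -- Step 4: the parent tangent flag `(g₀, t·X)` (`n_𝓕 = 1`) is valid
  have htanF : IsTangent E (PowerSeries.C t * PowerSeries.X : PowerSeries k) := isTangent_C_mul_X ht h0E h1E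
  have hnotN0F : ¬ IsN0 E (PowerSeries.C t * PowerSeries.X : PowerSeries k) := fun hN0 =>
    hN0.elim (fun h1 => h1 h1E) (fun h0 => htanF.2.1 h0)
  have hmmP : IsMMax d A E g₀ (PowerSeries.C t * PowerSeries.X) := by
    intro g' hg'
    rw [mOf_of_not_isN0 hnotN0F, mOf_of_not_isN0 hnotN0F, tangency_C_mul_X ht, hflagF, hflagF]
    refine mFlagN_mono _ _ ?_
    by_cases hN' : (newtonSet (shift d Ash g')).Nonempty
    · exact wOrdN_le_of_wMin_kWeight_le hPN hKP (hmaxP g')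
    · rw [Set.not_nonempty_iff_eq_empty] at hN'
      rw [hN', wOrdN_def, Set.image_empty, Nat.sInf_empty]
      exact Nat.zero_le _
  -- Step 5: the induced child re-centring `g′` and the child tuple `S = shift d A′ g′`
  have hlin : coeff (Finsupp.single 0 1) g₀ = 0 := coeff_X₀_eq_zero_of_wMin_le hd hAsh_pos (hmono ![1, 1])
  obtain ⟨g', hg'0, hind⟩ := exists_induced_hypersurface hT0 hφ' hg₀0 hlin
  have hS' : ∀ j : Fin d, (X 0 : MvPowerSeries (Fin 2) k) ^ (d - (j : ℕ)) * flagTuple d (shift d T φ') g' 0 j =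
      subst (PlaneGerm.dirChart (0 : k)) (shift d Ash g₀ j) := fun j => by rw [hind j, flagTuple_zero_shear]
  have hNS : newtonSet (flagTuple d (shift d T φ') g' 0) = psi L '' newtonSet (shift d Ash g₀) :=
    newtonSet_axisSucc _ _ hS' hPpos
  have hcleanS : IsWClean p ![n, 1] (flagTuple d (shift d T φ') g' 0) := by
    rw [isWClean_axisSucc_iff _ _ hS' p _ hPpos, srcWeight_n_one]
    exact hcleanN
  have hSne : flagTuple d (shift d T φ') g' 0 ≠ 0 := by
    rw [flagTuple_zero_shear]
    exact fun h0 => hex' (exit₃_of_shift_eq_zero p hg'0 h0)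
  have hfinS : wMin ![n, 1] (flagTuple d (shift d T φ') g' 0) ≠ ⊤ := wMin_ne_top_of_ne_zero _ hSne
  have hSL : ∀ Q ∈ newtonSet (flagTuple d (shift d T φ') g' 0), L ≤ Q 0 + Q 1 :=
    fun Q hQ => factorial_le_of_mem_newtonSet (fun j => le_order_flagTuple hpos' hg'0 (map_zero _) j) hQ
  have h624 : n * dInit ![n, 1] (newtonSet (flagTuple d (shift d T φ') g' 0)) ≤ initHeight 1 (newtonSet (shift d Ash g₀)) := by
    rw [hNS, initHeight_one_eq_gammaL]
    exact mul_dInit_image_psi_le_gammaL (w := ![n, 1]) (by simp) (by simp) hn1 hPN hPL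
  -- Step 6: the letter swap `ψ = swap g′`
  have hψ : constantCoeff (swap g') = 0 := by rw [swap, constantCoeff_rename]; exact hg'0
  have hflag : flagTuple d (swapT (shift d T φ')) (swap g') 0 = swapT (flagTuple d (shift d T φ') g' 0) := by
    rw [flagTuple_swapT_zero, PurePowerFlag.swap_swap]
  have hclean : IsWClean p ![1, n] (flagTuple d (swapT (shift d T φ')) (swap g') 0) := by
    rw [hflag, isWClean_swapT_iff]; exact hcleanS
  have hfin' : wMin ![1, n] (flagTuple d (swapT (shift d T φ')) (swap g') 0) ≠ ⊤ := by
    rw [hflag, wMin_swapT]; exact hfinS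
  have hdInit : dInit ![1, n] (newtonSet (flagTuple d (swapT (shift d T φ')) (swap g') 0)) =
      dInit ![n, 1] (newtonSet (flagTuple d (shift d T φ') g' 0)) := by
    rw [hflag, newtonSet_swapT, dInit_swap]
  refine ⟨g₀, swap g', hg₀0, hψ, hmmP, hclean, hfin', ?_⟩
  rw [hdInit, hflagF]
  -- Step 7: the conventions of `dFlagN L 1`; Perlega's `d_𝓕 = −1` makes the child an `Exit₃` position (Lemma 9.1.3)
  obtain ⟨Pf, hPf, hPfw, hPfh⟩ := exists_eq_initHeight 1 hPN
  have hδw : wOrdN 1 (newtonSet (shift d Ash g₀)) = deltaL (newtonSet (shift d Ash g₀)) := wOrdN_one_eq_deltaL _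
  have hPfd : Pf 0 + Pf 1 = deltaL (newtonSet (shift d Ash g₀)) := by rw [← hδw, ← hPfw]; ring
  have hPfmin : ∀ Q ∈ newtonSet (shift d Ash g₀), Q 0 + Q 1 = deltaL (newtonSet (shift d Ash g₀)) → Pf 1 ≤ Q 1 :=
    fun Q hQ hQd => by rw [hPfh]; exact initHeight_le 1 hQ (by rw [hδw, ← hQd]; ring)
  have hLδ : L ≤ deltaL (newtonSet (shift d Ash g₀)) := by
    obtain ⟨Q, hQ, hQd⟩ := exists_eq_deltaL hPN
    rw [← hQd]; exact hPL Q hQ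
  by_cases hle : L ≤ initHeight 1 (newtonSet (shift d Ash g₀))
  · rw [dFlagN_of_le hle]; exact h624
  rw [not_le] at hle
  by_cases hzero : initHeight 1 (newtonSet (shift d Ash g₀)) = 0
  · rw [hzero] at h624
    exact le_trans h624 (Nat.zero_le _)
  have hih0 : 0 < initHeight 1 (newtonSet (shift d Ash g₀)) := Nat.pos_of_ne_zero hzero
  by_cases hdvd : L ∣ mFlagN L 1 (newtonSet (shift d Ash g₀))
  swap
  · rw [dFlagN_of_lt_of_not_dvd hle hih0 hdvd]; exact h624
  exfalso
  have hmF : mFlagN L 1 (newtonSet (shift d Ash g₀)) = deltaL (newtonSet (shift d Ash g₀)) := by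
    rw [mFlagN_of_le (by rw [hδw]; omega), hδw]
  rw [hmF] at hdvd
  obtain ⟨q, hq⟩ := hdvd
  have hb0 : 0 < Pf 1 := by rw [hPfh]; exact hih0
  have hbL : Pf 1 < L := by rw [hPfh]; exact hle
  rcases Nat.eq_zero_or_pos q with hq0 | hqpos
  · rw [hq0, mul_zero] at hq
    have h := hLδ
    rw [hq] at h
    exact absurd h (not_le.mpr (Nat.factorial_pos d))
  obtain ⟨m, rfl⟩ : ∃ m, q = m + 1 := ⟨q - 1, by omega⟩
  rcases Nat.eq_zero_or_pos m with hm0 | hmpos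
  · -- `δ = L`: the child tuple would have a point of total degree `< L`
    rw [hm0, zero_add, mul_one] at hq
    obtain ⟨Q, hQ, hQlt⟩ := exists_lt_of_lost_image_psi (N := newtonSet (shift d Ash g₀)) (L := L) hq hPf hPfd hbL
    rw [← hNS] at hQ
    exact absurd (hSL Q hQ) (not_le.mpr hQlt)
  · -- `δ = L (m+1)`, `m ≥ 1`: small-residual shape, an `Exit₃` child
    obtain ⟨h1, h2, h3⟩ :=
      termSR_shape_of_lost_image_psi (N := newtonSet (shift d Ash g₀)) (L := L) hq hPf hPfd hPfmin hb0 hbL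
    rw [← hNS] at h1 h2 h3
    have hSpos : IsPos d (flagTuple d (shift d T φ') g' 0) := by
      refine isPos_of_forall_factorial_lt fun Q hQ => ?_
      have hQ0 := h1 Q hQ
      rcases (show L * m = Q 0 ∨ L * m < Q 0 by omega) with heq | hlt
      · have hQ1 := h2 Q hQ heq.symm
        have : L ≤ L * m := Nat.le_mul_of_pos_right L hmpos
        omega
      · have : L ≤ L * m := Nat.le_mul_of_pos_right L hmpos
        omega
    have hexS : Exit₃ p d (flagTuple d (shift d T φ') g' 0) :=
      exit₃_of_termSR_shape hSpos 0 hmpos h1 (fun Q hQ hQ0 => by simpa using h2 Q hQ hQ0) h3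
    rw [flagTuple_zero_shear, exit₃_shift_iff hg'0] at hexS
    exact hex' hexS

/-- **Uk-ρD3 (t ≠ 0) BY NAME: `DropKangarooTangent d p k`** over a perfect field of characteristic `p` (Perlega Prop. 9.1.4 case (4),
translated point): every valid kangaroo child flag `(true, g, h)`, `ord h = n ≥ 2`, lies strictly below `vmax`. -/
theorem dropKangarooTangent_holds (p : ℕ) [Fact p.Prime] [CharP k p] [PerfectRing k p] : DropKangarooTangent d p k := by
  intro A E t T φ' vmax hstep g h hg hh htan h2 hmm
  classical
  obtain ⟨hA, hexA, -, -, hvmax, ht, h0E, h1E, -, -, -, -⟩ := id hstep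
  have hd : 0 < d := by
    refine Nat.pos_of_ne_zero fun hd0 => ?_
    subst hd0
    exact hexA (exit₃_of_eq_zero hA fun j => j.elim0)
  -- the flag data
  have hh0 : h ≠ 0 := htan.2.1
  obtain ⟨hn2, hlow, hcn⟩ := order_toNat_spec hh0 h2
  set n := h.order.toNat with hn
  have htn : PurePowerFlag.tangency h = n := rfl
  have hnotN0 : ¬ IsN0 (swapE (succE t E)) h := by
    rintro (h1 | h0)
    · exact h1 htan.1
    · exact hh0 h0
  -- the package for this tangency
  obtain ⟨g₀, ψ, hg₀, hψ, hmax₀, hclean, hfin, h624⟩ := exists_translated_package p hstep hn2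
  set C' := swapT (shift d T φ') with hC'
  set Astar := flagTuple d C' ψ 0 with hAstar
  -- the child flag tuple as a shift of the sheared clean tuple
  have hψσ : constantCoeff (subst (PurePowerFlag.shift h) ψ) = 0 := constantCoeff_subst_shear hh hψ
  have htuple : flagTuple d C' g h =
      shift d (fun j => subst (PurePowerFlag.shift h) (Astar j)) (g - subst (PurePowerFlag.shift h) ψ) := by
    rw [hAstar, ← flagTuple_def, flagTuple_flagTuple C' ψ _ (map_zero _) hh, zero_add, add_sub_cancel]
  have htuple0 : flagTuple d C' (subst (PurePowerFlag.shift h) ψ) h = fun j => subst (PurePowerFlag.shift h) (Astar j) := by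
    have h1 : flagTuple d C' (subst (PurePowerFlag.shift h) ψ) h = shift d (fun j => subst (PurePowerFlag.shift h) (Astar j)) 0 := by
      rw [hAstar, ← flagTuple_def, flagTuple_flagTuple C' ψ _ (map_zero _) hh, zero_add, add_zero]
    rw [h1, shift_zero]
  obtain ⟨m, hm⟩ : ∃ m : ℕ, wMin ![1, n] Astar = m := ENat.ne_top_iff_exists.mp hfin |>.imp fun m hm => hm.symm
  have hval : mFlagN d.factorial n (newtonSet (fun j => subst (PurePowerFlag.shift h) (Astar j))) ≤
      mFlagN d.factorial n (newtonSet (shift d (fun j => subst (PurePowerFlag.shift h) (Astar j)) (g - subst (PurePowerFlag.shift h) ψ))) := by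
    have h1 := hmm _ hψσ
    rw [mOf_of_not_isN0 hnotN0, mOf_of_not_isN0 hnotN0, htn, htuple0, htuple] at h1
    exact h1
  have hnotN0F : ¬ IsN0 E (PowerSeries.C t * PowerSeries.X : PowerSeries k) := by
    rintro (h1 | h0)
    · exact h1 h1E
    · exact (isTangent_C_mul_X ht h0E h1E).2.1 h0
  by_cases hdpos : 0 < dFlagN d.factorial 1 (newtonSet (flagTuple d A g₀ (PowerSeries.C t * PowerSeries.X)))
  · -- the kangaroo bound against `d_𝓕 > 0` of the parent tangent flag `(g₀, t·X)`: `(d_𝓖, n, 0) < (d_𝓕, 1, 0) ≤ vmax`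
    have hdrop := dFlagN_shift_lt (w := ![1, n]) (by simp) (by simp) (by omega) hlow rfl hcn Astar p hn2 hclean hm
      (g - subst (PurePowerFlag.shift h) ψ) hval hdpos h624
    rw [← htuple] at hdrop
    have hF : IsFlagTriple d A E (flagTriple d A E g₀ (PowerSeries.C t * PowerSeries.X)) :=
      isFlagTriple_of_first hg₀ (constantCoeff_C_mul_X t) (Or.inr (isTangent_C_mul_X ht h0E h1E)) hmax₀
    refine lt_of_lt_of_le ?_ (hvmax _ hF)
    rw [flagTriple_of_not_isN0 hnotN0, flagTriple_of_not_isN0 hnotN0F, htn, tangency_C_mul_X ht]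
    exact Prod.Lex.toLex_lt_toLex.mpr (Or.inl hdrop)
  · -- `d_𝓕 = 0`: `dInit = 0`, so `d_𝓖 = 0`, and a valid parent flag with positive first entry lies below `vmax`
    have hdInit0 : dInit ![1, n] (newtonSet Astar) = 0 := by
      have h0 : n * dInit ![1, n] (newtonSet Astar) = 0 := by omega
      rcases Nat.mul_eq_zero.mp h0 with hn0 | h
      · omega
      · exact h
    have hzero := dFlagN_shift_eq_zero_of_dInit_eq_zero (w := ![1, n]) (by simp) (by simp) (by omega) hlow rfl hcn Astar p
      hclean hm (g - subst (PurePowerFlag.shift h) ψ) hval hdInit0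
    rw [← htuple] at hzero
    obtain ⟨v, hv, hvpos⟩ := exists_isFlagTriple_fst_pos p hd hA hexA E
    refine lt_of_lt_of_le ?_ (hvmax v hv)
    rw [flagTriple_of_not_isN0 hnotN0, htn, hzero, ← toLex_ofLex v]
    exact Prod.Lex.toLex_lt_toLex.mpr (Or.inl hvpos)

end WildMonic

end Summit.ResolutionOfSingularities.ResolutionOfSingularities.Theorems

end
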